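import Literature.Barriers.FinalStateConjecture.NonSmoothNullInfinityScatteringCalculus
import Literature.Analysis.Calculus.HadamardLemma
import HarnessLib

/-!
# Barrier catalogue `FinalStateConjecture`: the linear scattering problem on Schwarzschild —
# the time integral of a scattering solution
(`Literature/Barriers/FinalStateConjecture/`, D-0021, D-0014; family `gr`; namespace
`Literature.Barriers.FinalStateConjecture`; second instalment of the discharge of
`SchwarzschildLinearScattering_uDecay`, Kehrberger's estimate (6.17))

In the proof of Thm. 6.2 of Kehrberger (arXiv:2105.08079v3) the scattering solution `rφ` with data
`G` is written as the time derivative `T(rφ^T) = (∂ᵤ + ∂ᵥ)(rφ^T)` of "the time integral of `rφ`",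
the scattering solution `rφ^T` with data `G^T(v) = ∫_{v₁}^{v} G` — obtained there from an existence
theorem ([DRSR]) and identified by uniqueness ("since `T` also commutes with the wave equation, we
indeed have `T(rφ^T) = rφ` by uniqueness"). `…ScatteringCalculus.lean` writes the time integral down
explicitly, `timeIntegral v₁ ψ (u, v) = ∫_{v₁}^{v} ψ(u − v + y, y) dy` (integrate `ψ` backwards along
the time-translation orbit through `(u, v)` until `{v = v₁}`). This file proves that this explicit
object has all the properties used in the proof of Thm. 6.2, for any scattering solution `ψ`
(`IsScatteringSolution M r v₁ G ψ`, `M > 0`):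

* `contDiff_timeIntegral` — `ψ^T` is jointly smooth (substitute to the unit interval and
  differentiate under the integral sign, `Literature.Analysis.Calculus.contDiff_intervalIntegral`);
* `partialU_add_partialV_timeIntegral` — `(∂ᵤ + ∂ᵥ)ψ^T = ψ` (along the orbit only the upper limit
  moves: fundamental theorem of calculus versus the chain rule);
* `hasDerivAt_timeIntegral_fst`, `partialU_timeIntegral`, `partialV_timeIntegral` —
  `∂ᵤ(ψ^T) = (∂ᵤψ)^T` (differentiation under the integral sign) and hence `∂ᵥψ^T = ψ − (∂ᵤψ)^T`;
* `isRadiationFieldOnSchwarzschild_timeIntegral` — `∂ᵤ∂ᵥψ^T = Vψ^T` ("`T` also commutes with the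
  wave equation": FTC along the orbit for `∂ᵤψ`, `∂ᵥ∂ᵤψ = ∂ᵤ∂ᵥψ = Vψ`, and the time-translation
  invariance `V(u − v + y, y) = V(u, v)`), given that `ψ` vanishes on `{v ≤ v₁}`;
* `IsScatteringSolution.timeIntegral` — **`ψ^T` is a scattering solution with data
  `G^T = scatteringTimeIntegral v₁ G`** (data attained by dominated convergence, past-quadrant bounds
  inherited), and `IsScatteringSolution.eq_T_timeIntegral` — `ψ = ∂ᵤψ^T + ∂ᵥψ^T`.

Relation to `NonSmoothNullInfinityScatteringProofs.lean`: that file discharges the named fact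
`SchwarzschildLinearScattering_timeIntegral` (`ψ = TψT` for any two scattering solutions `ψ`, `ψT`
with data `G`, `G^T`) following the printed route (`T` commutes with the equation, limits of `∂ᵤψT`,
`∂ᵥψT` at `𝓘⁻`, uniqueness), taking `ψT` as GIVEN. What the induction on `n` in the proof of (6.17)
needs, and what is supplied here, is the EXISTENCE of the time integral as a scattering solution for
every scattering solution `ψ` — without the existence fact `SchwarzschildLinearScattering_exists` —
together with the formulas `∂ᵤψ^T = (∂ᵤψ)^T`, `∂ᵥψ^T = ψ − (∂ᵤψ)^T` used to estimate its derivatives.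
By `IsScatteringSolution.unique` (ibid.) any `ψT` as in the fact coincides with `timeIntegral v₁ ψ`.

## References

* L. M. A. Kehrberger, *The case against smooth null infinity I: heuristics and counter-examples*,
  Ann. Henri Poincaré 23 (2022) 829–921 = arXiv:2105.08079 (v3, 2023), proof of Thm. 6.2,
  eqs. (6.22)–(6.23) ("The crucial idea is to use time integrals"). Key `Kehrberger2022AHP`.
* M. Dafermos, I. Rodnianski, Y. Shlapentokh-Rothman, Ann. Sci. ÉNS 51 (2018) 371–486 (the
  existence/uniqueness statement quoted by Kehrberger, not needed here). Key
  `DafermosRodnianskiShlapentokhrothman2018`.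
-/

noncomputable section

open Set Filter Topology MeasureTheory

namespace Literature.Barriers.FinalStateConjecture

section Smooth

variable {v₁ : ℝ} {ψ : ℝ → ℝ → ℝ}

/-- **The time integral of a jointly smooth function is jointly smooth** (write it over the unit
interval and differentiate under the integral sign, `Literature.Analysis.Calculus.contDiff_intervalIntegral`).
[folklore] -/
theorem contDiff_timeIntegral (hψ : ContDiff ℝ ((⊤ : ℕ∞) : WithTop ℕ∞) (Function.uncurry ψ)) :
    ContDiff ℝ ((⊤ : ℕ∞) : WithTop ℕ∞) (Function.uncurry (timeIntegral v₁ ψ)) := by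
  set F : ℝ × ℝ → ℝ → ℝ := fun p t ↦
    ψ (p.1 - p.2 + ((p.2 - v₁) * t + v₁)) ((p.2 - v₁) * t + v₁) with hF
  have hFs : ContDiff ℝ ((⊤ : ℕ∞) : WithTop ℕ∞) (Function.uncurry F) := by
    have hA : ContDiff ℝ ((⊤ : ℕ∞) : WithTop ℕ∞) (fun q : (ℝ × ℝ) × ℝ ↦
        (q.1.1 - q.1.2 + ((q.1.2 - v₁) * q.2 + v₁), (q.1.2 - v₁) * q.2 + v₁)) := by
      fun_prop
    exact hψ.comp hA
  have hI : ContDiff ℝ ((⊤ : ℕ∞) : WithTop ℕ∞) (fun p : ℝ × ℝ ↦ ∫ t in (0 : ℝ)..1, F p t) :=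
    Literature.Analysis.Calculus.contDiff_intervalIntegral (n := ⊤) hFs 0 1
  have heq : Function.uncurry (timeIntegral v₁ ψ) =
      fun p : ℝ × ℝ ↦ (p.2 - v₁) * ∫ t in (0 : ℝ)..1, F p t := by
    funext p
    simp only [hF]
    exact timeIntegral_eq_unit v₁ ψ p.1 p.2
  rw [heq]
  exact (contDiff_snd.sub contDiff_const).mul hI

/-- **`(∂ᵤ + ∂ᵥ)ψ^T = ψ`** for jointly continuous-and-smooth `ψ`: along the orbit
`s ↦ (u + s, v + s)` only the upper limit of `ψ^T` moves, so the derivative at `s = 0` is the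
integrand at the endpoint, `ψ(u, v)` (fundamental theorem of calculus), while by the chain rule it
is `(∂ᵤψ^T + ∂ᵥψ^T)(u, v)`. [cite: Kehrberger2022AHP, proof of Thm. 6.2, eq. (6.23)] -/
theorem partialU_add_partialV_timeIntegral
    (hψ : ContDiff ℝ ((⊤ : ℕ∞) : WithTop ℕ∞) (Function.uncurry ψ)) (u v : ℝ) :
    partialU (timeIntegral v₁ ψ) u v + partialV (timeIntegral v₁ ψ) u v = ψ u v := by
  have h1 := hasDerivAt_diag_zero (contDiff_timeIntegral (v₁ := v₁) hψ) u v
  -- the same derivative computed by FTC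
  have hc : Continuous fun y ↦ ψ (u - v + y) y :=
    hψ.continuous.comp ((continuous_const.add continuous_id).prodMk continuous_id)
  have h2 : HasDerivAt (fun s ↦ timeIntegral v₁ ψ (u + s) (v + s)) (ψ (u - v + (v + 0)) (v + 0)) 0 := by
    have hI : HasDerivAt (fun w ↦ ∫ y in v₁..w, ψ (u - v + y) y) (ψ (u - v + (v + 0)) (v + 0)) (v + 0) :=
      intervalIntegral.integral_hasDerivAt_right (hc.intervalIntegrable _ _)
        (hc.stronglyMeasurableAtFilter _ _) hc.continuousAt
    have := HasDerivAt.comp_const_add (f := fun w ↦ ∫ y in v₁..w, ψ (u - v + y) y) v 0 hI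
    simp only [timeIntegral_diag]
    exact this
  have := h1.unique h2
  simpa using this

/-- **`∂ᵤ` commutes with the time integral**: `∂ᵤ(φ^T) = (∂ᵤφ)^T` for jointly smooth `φ`
(differentiation under the integral sign; the limits of `φ^T(·, v)` do not depend on `u`).
[folklore] -/
theorem hasDerivAt_timeIntegral_fst (hψ : ContDiff ℝ ((⊤ : ℕ∞) : WithTop ℕ∞) (Function.uncurry ψ))
    (u v : ℝ) : HasDerivAt (fun u' ↦ timeIntegral v₁ ψ u' v) (timeIntegral v₁ (partialU ψ) u v) u := by
  simp only [timeIntegral_apply]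
  have hUc : Continuous (Function.uncurry (partialU ψ)) := (contDiff_partialU hψ).continuous
  have hc : ∀ u', Continuous fun y ↦ ψ (u' - v + y) y := fun u' ↦
    hψ.continuous.comp ((continuous_const.add continuous_id).prodMk continuous_id)
  have hc' : ∀ u', Continuous fun y ↦ partialU ψ (u' - v + y) y := fun u' ↦
    hUc.comp ((continuous_const.add continuous_id).prodMk continuous_id)
  -- a uniform bound for the derivative on `closedBall u 1 × [v₁, v]`
  obtain ⟨C, hC⟩ := ((isCompact_closedBall u 1).prod (isCompact_uIcc (a := v₁) (b := v)))
    |>.exists_bound_of_continuousOn (f := fun p : ℝ × ℝ ↦ partialU ψ (p.1 - v + p.2) p.2)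
      ((hUc.comp ((continuous_fst.sub continuous_const).add continuous_snd |>.prodMk
        continuous_snd)).continuousOn)
  have key := intervalIntegral.hasDerivAt_integral_of_dominated_loc_of_deriv_le
    (𝕜 := ℝ) (μ := volume) (a := v₁) (b := v) (bound := fun _ ↦ C)
    (F := fun u' y ↦ ψ (u' - v + y) y) (F' := fun u' y ↦ partialU ψ (u' - v + y) y) (x₀ := u)
    (Metric.ball_mem_nhds u one_pos) ?_ ?_ ?_ ?_ ?_ ?_
  · exact key.2
  · exact Eventually.of_forall fun u' ↦ (hc u').aestronglyMeasurable
  · exact (hc u).intervalIntegrable _ _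
  · exact (hc' u).aestronglyMeasurable
  · refine Eventually.of_forall fun y hy u' hu' ↦ ?_
    exact hC (u', y) ⟨Metric.ball_subset_closedBall hu', uIoc_subset_uIcc hy⟩
  · exact intervalIntegrable_const
  · refine Eventually.of_forall fun y _ u' _ ↦ ?_
    have h := hasDerivAt_partialU hψ (u' - v + y) y
    have h' : HasDerivAt (fun x ↦ ψ x y) (partialU ψ (u' - v + y) y) (u' + (-v + y)) := by
      rw [show u' + (-v + y) = u' - v + y by ring]; exact h
    have := HasDerivAt.comp_add_const (f := fun x ↦ ψ x y) u' (-v + y) h'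
    refine this.congr_of_eventuallyEq (Eventually.of_forall fun x ↦ ?_)
    simp only; congr 1; ring

/-- `∂ᵤ(φ^T) = (∂ᵤφ)^T` as an identity of functions. [folklore] -/
theorem partialU_timeIntegral (hψ : ContDiff ℝ ((⊤ : ℕ∞) : WithTop ℕ∞) (Function.uncurry ψ)) :
    partialU (timeIntegral v₁ ψ) = timeIntegral v₁ (partialU ψ) := by
  funext u v
  exact (hasDerivAt_timeIntegral_fst hψ u v).deriv

/-- `∂ᵥ(φ^T) = φ − (∂ᵤφ)^T`. [folklore] -/
theorem partialV_timeIntegral (hψ : ContDiff ℝ ((⊤ : ℕ∞) : WithTop ℕ∞) (Function.uncurry ψ)) :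
    partialV (timeIntegral v₁ ψ) = fun u v ↦ ψ u v - timeIntegral v₁ (partialU ψ) u v := by
  funext u v
  have h := partialU_add_partialV_timeIntegral (v₁ := v₁) hψ u v
  rw [partialU_timeIntegral hψ] at h
  linarith

end Smooth

/-! ### The time integral of a scattering solution is a scattering solution -/

section Scattering

variable {M : ℝ} {r : ℝ → ℝ → ℝ} {v₁ : ℝ} {G : ℝ → ℝ} {ψ : ℝ → ℝ → ℝ}

/-- The time integral vanishes on `{v ≤ v₁}` if `ψ` does. [folklore] -/
theorem timeIntegral_eq_zero_of_le (hz : ∀ u v, v ≤ v₁ → ψ u v = 0) (u : ℝ) {v : ℝ}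
    (hv : v ≤ v₁) : timeIntegral v₁ ψ u v = 0 := by
  rw [timeIntegral_apply]
  have : ∫ y in v₁..v, ψ (u - v + y) y = ∫ y in v₁..v, (0 : ℝ) := by
    refine intervalIntegral.integral_congr fun y hy ↦ ?_
    rw [uIcc_of_ge hv] at hy
    exact hz _ _ hy.2
  rw [this, intervalIntegral.integral_zero]

/-- **The time integral of a radiation field vanishing on `{v ≤ v₁}` is a radiation field**:
`∂ᵤ∂ᵥψ^T = Vψ^T`. With `∂ᵥψ^T = ψ − (∂ᵤψ)^T` and `∂ᵤ(∂ᵤψ)^T = (∂ᵤ²ψ)^T` this is the identity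
`∂ᵤψ(u, v) = ∫_{v₁}^{v} [(∂ᵤ² + ∂ᵥ∂ᵤ)ψ](u − v + y, y) dy` (fundamental theorem of calculus along the
orbit, `∂ᵤψ(·, v₁) = 0`) together with `∂ᵥ∂ᵤψ = Vψ` and the time-translation invariance
`V(u − v + y, y) = V(u, v)` ("since `T` also commutes with the wave equation", proof of Thm. 6.2).
[cite: Kehrberger2022AHP, proof of Thm. 6.2] -/
theorem isRadiationFieldOnSchwarzschild_timeIntegral (hM : 0 < M) (hr : IsEFAreaRadius M r)
    (hψ : IsRadiationFieldOnSchwarzschild M r ψ) (hz : ∀ u v, v ≤ v₁ → ψ u v = 0) :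
    IsRadiationFieldOnSchwarzschild M r (timeIntegral v₁ ψ) := by
  have hs := hψ.1
  have hsU := contDiff_partialU hs
  have hT := contDiff_timeIntegral (v₁ := v₁) hs
  refine ⟨hT, fun u v ↦ ?_⟩
  -- `∂ᵤ∂ᵥψ^T = ∂ᵤψ − (∂ᵤ²ψ)^T`
  have h1 : deriv (fun u' ↦ deriv (fun v' ↦ timeIntegral v₁ ψ u' v') v) u =
      partialU ψ u v - timeIntegral v₁ (partialU (partialU ψ)) u v := by
    have hV : (fun u' ↦ deriv (fun v' ↦ timeIntegral v₁ ψ u' v') v) =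
        fun u' ↦ ψ u' v - timeIntegral v₁ (partialU ψ) u' v := by
      funext u'
      have := congrFun (congrFun (partialV_timeIntegral (v₁ := v₁) hs) u') v
      simpa [partialV] using this
    rw [hV]
    have hd := (hasDerivAt_partialU hs u v).sub (hasDerivAt_timeIntegral_fst (v₁ := v₁) hsU u v)
    exact hd.deriv
  -- the diagonal identity
  have h2 : partialU ψ u v = timeIntegral v₁ (partialU (partialU ψ)) u v +
      efPotential M r u v * timeIntegral v₁ ψ u v := by
    set g : ℝ → ℝ := fun y ↦ partialU ψ (u - v + y) y with hg
    have hg' : ∀ y, HasDerivAt g (partialU (partialU ψ) (u - v + y) y +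
        efPotential M r u v * ψ (u - v + y) y) y := by
      intro y
      have h := hasDerivAt_diag hsU (u - v) y
      refine h.congr_deriv ?_
      rw [partialV_partialU_eq hs, hψ.partialU_partialV, efPotential_diag hr hM.le]
    have hcont : Continuous fun y ↦ partialU (partialU ψ) (u - v + y) y +
        efPotential M r u v * ψ (u - v + y) y :=
      ((contDiff_partialU hsU).continuous.comp
        ((continuous_const.add continuous_id).prodMk continuous_id)).add
        (continuous_const.mul (hs.continuous.comp
          ((continuous_const.add continuous_id).prodMk continuous_id)))
    have hftc := intervalIntegral.integral_eq_sub_of_hasDerivAt (a := v₁) (b := v)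
      (fun y _ ↦ hg' y) (hcont.intervalIntegrable _ _)
    have hgv : g v = partialU ψ u v := by simp [hg]
    have hgv₁ : g v₁ = 0 := by
      simp only [hg, partialU]
      have : (fun u' ↦ ψ u' v₁) = fun _ ↦ 0 := funext fun u' ↦ hz u' v₁ le_rfl
      rw [this, deriv_const]
    rw [hgv, hgv₁, sub_zero, intervalIntegral.integral_add, intervalIntegral.integral_const_mul]
      at hftc
    · rw [← hftc, timeIntegral_apply, timeIntegral_apply]
    · exact (((contDiff_partialU hsU).continuous.comp
        ((continuous_const.add continuous_id).prodMk continuous_id))).intervalIntegrable _ _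
    · exact (continuous_const.mul (hs.continuous.comp
        ((continuous_const.add continuous_id).prodMk continuous_id))).intervalIntegrable _ _
  rw [h1, h2, efPotential]
  ring

/-- Past-quadrant bounds transfer to the time integral: `|ψ^T(u, v)| ≤ (V − v₁) B` on
`{u ≤ U, v ≤ V}` if `|ψ| ≤ B` there (and `ψ = 0` on `{v ≤ v₁}`). [folklore] -/
theorem abs_timeIntegral_le (hz : ∀ u v, v ≤ v₁ → ψ u v = 0) {U V B : ℝ} (hB0 : 0 ≤ B)
    (hB : ∀ u, u ≤ U → ∀ v, v ≤ V → |ψ u v| ≤ B) {u v : ℝ} (hu : u ≤ U) (hv : v ≤ V) :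
    |timeIntegral v₁ ψ u v| ≤ |V - v₁| * B := by
  rcases le_or_gt v v₁ with hvv | hvv
  · rw [timeIntegral_eq_zero_of_le hz u hvv, abs_zero]; positivity
  · rw [timeIntegral_apply]
    have key := intervalIntegral.norm_integral_le_of_norm_le_const (a := v₁) (b := v) (C := B)
      (f := fun y ↦ ψ (u - v + y) y) fun y hy ↦ ?_
    · rw [Real.norm_eq_abs] at key
      refine key.trans ?_
      rw [mul_comm]
      refine mul_le_mul_of_nonneg_right ?_ hB0
      rw [abs_of_nonneg (by linarith : 0 ≤ v - v₁), abs_of_nonneg (by linarith : 0 ≤ V - v₁)]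
      linarith
    · rw [uIoc_of_le hvv.le] at hy
      rw [Real.norm_eq_abs]
      exact hB _ (by linarith [hy.2]) _ (hy.2.trans hv)

/-- **The time integral of a scattering solution with data `G` is a scattering solution with
data `G^T = ∫_{v₁}^{·} G`** (`scatteringTimeIntegral v₁ G`): it is a radiation field
(`isRadiationFieldOnSchwarzschild_timeIntegral`), vanishes on `{v ≤ v₁}`, attains `G^T` on `𝓘⁻`
(dominated convergence under the integral sign, using the past-quadrant bound of `ψ`), and is
bounded on past quadrants. This is the solution "`rφ^T` arising from `G^T`" of the proof of
Thm. 6.2, constructed here without appeal to an existence theorem.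
[cite: Kehrberger2022AHP, proof of Thm. 6.2, eqs. (6.22)–(6.23)] -/
theorem IsScatteringSolution.timeIntegral (hM : 0 < M) (hr : IsEFAreaRadius M r)
    (h : IsScatteringSolution M r v₁ G ψ) :
    IsScatteringSolution M r v₁ (scatteringTimeIntegral v₁ G) (timeIntegral v₁ ψ) := by
  have hz : ∀ u v, v ≤ v₁ → ψ u v = 0 := fun u v hv ↦ h.eq_zero hv
  refine ⟨isRadiationFieldOnSchwarzschild_timeIntegral hM hr h.isRadiationField hz,
    fun u v hv ↦ timeIntegral_eq_zero_of_le hz u hv, fun v ↦ ?_, fun U V ↦ ?_⟩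
  · -- the data: dominated convergence
    obtain ⟨B, hB⟩ := h.exists_bound (max v₁ v - v) (max v₁ v)
    simp only [timeIntegral_apply, scatteringTimeIntegral_apply]
    refine intervalIntegral.tendsto_integral_filter_of_dominated_convergence (fun _ ↦ max B 0)
      ?_ ?_ intervalIntegrable_const ?_
    · exact Eventually.of_forall fun u ↦ (h.contDiff.continuous.comp
        ((continuous_const.add continuous_id).prodMk continuous_id)).aestronglyMeasurable
    · filter_upwards [eventually_le_atBot (0 : ℝ)] with u hu
      refine Eventually.of_forall fun y hy ↦ ?_
      rw [Real.norm_eq_abs]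
      have hy2 : y ≤ max v₁ v := (uIoc_subset_uIcc hy).2
      exact (hB _ (by linarith) _ hy2).trans (le_max_left _ _)
    · refine Eventually.of_forall fun y _ ↦ ?_
      have := (h.tendsto_atBot y).comp (tendsto_atBot_add_const_right atBot (-v + y) tendsto_id)
      refine this.congr fun u ↦ ?_
      simp only [Function.comp_apply, id]
      congr 1; ring
  · obtain ⟨B, hB⟩ := h.exists_bound U V
    refine ⟨|V - v₁| * max B 0, fun u hu v hv ↦ ?_⟩
    exact abs_timeIntegral_le hz (le_max_right _ _)
      (fun u hu v hv ↦ (hB u hu v hv).trans (le_max_left _ _)) hu hv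

/-- **`ψ = (∂ᵤ + ∂ᵥ)ψ^T`** for a scattering solution `ψ` ("`T(rφ^T) = rφ`", proof of Thm. 6.2).
[cite: Kehrberger2022AHP, proof of Thm. 6.2, eq. (6.23)] -/
theorem IsScatteringSolution.eq_T_timeIntegral (h : IsScatteringSolution M r v₁ G ψ) (u v : ℝ) :
    ψ u v = partialU (Literature.Barriers.FinalStateConjecture.timeIntegral v₁ ψ) u v +
      partialV (Literature.Barriers.FinalStateConjecture.timeIntegral v₁ ψ) u v :=
  (partialU_add_partialV_timeIntegral h.contDiff u v).symm

end Scattering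

end Literature.Barriers.FinalStateConjecture

end
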